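import Summits.CriticalPhenomena.PercolationContinuityZ3.Theorems.PercNearOneGluingNoHeavyLowerTailSahiCombShapeCheck
import Mathlib.Data.Fin.Tuple.Sort

/-!
# The comb (tensor-Bernstein) hierarchy for Sahi's `E_k`, XIV: the shape scan on SORTED tuples (slot symmetry of the comb array) — soundness

Support file of the one-cut programme (crux `NoHeavyLowerTail`, stmt-CriticalPhenomena-4575; cell `prim-masterthm`, seat P5).
The comb array does not depend on the order of the slots (`SahiComb.combCoeff_comp_perm`, `…SahiCombSymmetry`), so the digit scan of
`…SahiCombShapeCheck` need only visit the `n`-MULTISETS of increasing bitmasks (tuples sorted by bitmask value), a factor `≈ n!` fewer: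

* `SahiComb.isSortedTuple`, `SahiComb.checkShapeCubeSorted σ m n KT F off` — the scan restricted to nondecreasing tuples;
* **`SahiComb.shape_of_checkShapeCubeSorted`** — the same conclusion as `shape_of_checkShapeCube` (ENDMIN, ORDER-1, UNI of every coefficient
  line of every `n`-tuple of increasing events of `2^{Fin m}`), via Mathlib's sorting permutation `Tuple.sort` and slot symmetry.
Cells in `…SahiCombShapeCellsNativeSorted`.  Everything here is proved; axioms standard. [this work]
-/

noncomputable section

open scoped Classical

namespace Summit.CriticalPhenomena.PercolationContinuityZ3.Theorems

open Finset Function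
open Literature.Combinatorics.Sahi2008
open Literature.Probability.Percolation.DecisionTree (ind)
open SahiComb SahiC3Cube NCopyCert OneCutCert

namespace SahiComb

/-- A tuple of naturals is sorted (nondecreasing along `Fin n`). [folklore] -/
def isSortedTuple {n : ℕ} (a : Fin n → ℕ) : Bool :=
  (List.finRange n).all fun i => (List.finRange n).all fun i' => !decide (i ≤ i') || decide (a i ≤ a i')

/-- Specification of `isSortedTuple`. [folklore] -/
theorem isSortedTuple_of_monotone {n : ℕ} {a : Fin n → ℕ} (h : Monotone a) : isSortedTuple a = true := by
  unfold isSortedTuple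
  simp only [List.all_eq_true, List.mem_finRange, true_implies, Bool.or_eq_true, Bool.not_eq_true', decide_eq_false_iff_not,
    decide_eq_true_eq]
  intro i i'
  by_cases hii : i ≤ i'
  · exact Or.inr (h hii)
  · exact Or.inl hii

/-- **Shape scan over the sorted tuples only.** [this work] -/
def checkShapeCubeSorted (σ m n : ℕ) (KT : ℕ → ℤ) (F off : ℤ) : Bool :=
  ((tuples (upsN m) n).filter isSortedTuple).all (checkShapeFam σ m n KT F off)

/-- The scan over all tuples that are sorted passes if the sorted scan passes (repackaging). [this work] -/
theorem checkShapeFam_of_sorted {σ m n : ℕ} {KT : ℕ → ℤ} {F off : ℤ} (h : checkShapeCubeSorted σ m n KT F off = true)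
    {a : Fin n → ℕ} (ha : a ∈ tuples (upsN m) n) (hs : isSortedTuple a = true) : checkShapeFam σ m n KT F off a = true := by
  unfold checkShapeCubeSorted at h
  rw [List.all_eq_true] at h
  exact h a (List.mem_filter.2 ⟨ha, hs⟩)

/-- Slot permutations do not change coefficient lines. [this work] -/
theorem combLine_comp_perm {ι : Type*} [Fintype ι] {k : ℕ} (τ : Equiv.Perm (Fin k)) (U : Fin k → Set (Set ι)) (e : ι)
    (j : ι → ℕ) (t : ℕ) : combLine k (fun i => U (τ i)) e j t = combLine k U e j t := by
  unfold combLine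
  exact combCoeff_comp_perm τ (fun i => ind (U i)) _

/-- **Soundness of the sorted scan**: same conclusion as `shape_of_checkShapeCube`. [this work] -/
theorem shape_of_checkShapeCubeSorted {m n σ : ℕ} (hσ : 0 < σ) (hbnd : coefBound m n < 2 ^ (σ - 1)) {KT : ℕ → ℤ}
    (hKT : ∀ T, KT T = (krTB σ (n + 1) m T : ℤ))
    (h : checkShapeCubeSorted σ m n KT (krTB σ (n + 1) m (fullN m)) (maskN σ ((n + 1) ^ m)) = true)
    (hn : 1 ≤ n) (U : Fin n → Set (Set (Fin m))) (hU : ∀ i, IsUpperSet (U i)) (e : Fin m) (j : Fin m → ℕ) :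
    (∀ t, t ≤ n → min (combLine n U e j 0) (combLine n U e j n) ≤ combLine n U e j t) ∧
      (combLine n U e j 0 ≤ combLine n U e j 1 ∧ combLine n U e j n ≤ combLine n U e j (n - 1)) ∧
      ∃ mo, mo ≤ n ∧ MonotoneOn (combLine n U e j) (Set.Icc 0 mo) ∧ AntitoneOn (combLine n U e j) (Set.Icc mo n) := by
  -- sort the bitmasks of `U`
  set a : Fin n → ℕ := fun i => encA m (U i) with ha
  let τ : Equiv.Perm (Fin n) := Tuple.sort a
  have hmono : Monotone (a ∘ τ) := Tuple.monotone_sort a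
  set V : Fin n → Set (Set (Fin m)) := fun i => U (τ i) with hV
  have hVup : ∀ i, IsUpperSet (V i) := fun i => hU (τ i)
  -- the scan of `V`'s (sorted) bitmasks passes
  have hfam : checkShapeFam σ m n KT (krTB σ (n + 1) m (fullN m)) (maskN σ ((n + 1) ^ m)) (fun i => encA m (V i)) = true :=
    checkShapeFam_of_sorted h (mem_tuples _ fun i => encA_mem_upsN (hVup i)) (isSortedTuple_of_monotone hmono)
  have key := shape_of_checkShapeFam hσ hbnd hKT hfam hn e j
  have hfun : combLine n V e j = combLine n U e j := funext fun t => combLine_comp_perm τ U e j t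
  rw [hfun] at key
  exact key

end SahiComb

end Summit.CriticalPhenomena.PercolationContinuityZ3.Theorems
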